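import Literature.NumberTheory.EllipticCurves.Kato2004.IwasawaH1ReductionPkNumberField
import Literature.NumberTheory.EllipticCurves.HeegnerModuleIndex
import Literature.NumberTheory.EllipticCurves.GaloisActionProofs
import Literature.NumberTheory.EllipticCurves.PointDivisibilityProofs
import Mathlib.CategoryTheory.CofilteredSystem
import Mathlib.CategoryTheory.Functor.OfSequence
import HarnessLib

/-!
# Kato 2004 (Astérisque 295) §8.2 / Rubin, *Euler Systems*, App. B Prop. B.2.3 OVER A NUMBER FIELD `K`:
# `H¹(U, T_pE) ≅ lim←_k H¹(U, E[p^k])` for `U ≤ Γ_K` — SEPARATEDNESS (a class with all reductions zero is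
# zero) and SURJECTIVITY (every `p_*`-compatible family of classes lifts) — the `K`-TWIN, word for word,
# of `Kato2004/IwasawaH1ReductionSeparated.lean` §1–§2 and `Kato2004/IwasawaH1ReductionSurjectiveProofs.lean` §1–§3

Topic `NumberTheory/EllipticCurves`, sub-directory `Kato2004` (namespace = path).  Cell `bsd-cm`, seat
`bsd-cm-k-ty1` g30 (literature-prover), row K2C-8 (C5) file T2b (first half) of the (C5-0) typing memo
`pub/bsd-cm/bsd-cm-k-ty1/g30/C5-typing-memo.md` (19c5e03c2b551001), planner ruling D1019 (B) Q2; crux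
stmt-BirchSwinnertonDyer-19945 (`EllipticUnitValueSevenOfGZK`, route K7r).  THEOREMS ONLY (no definition, no named
fact, no `sorry`, no instance, no notation).  Nothing about any particular curve, CM or BSD is claimed; no summit
statement is proved by this file.

## The printed statements

* K. Kato, Astérisque 295 (2004) **§8.2 [pp. 180–181]** (GENERAL field of fractions `K`): "`H^q(R, T) =
  lim←_n H^q(R, T/p^n)`" for a finitely generated `ℤ_p`-module `T` with continuous action.
* K. Rubin, *Euler Systems* (2000) **App. B, Prop. B.2.3**: "Suppose `T` is a finitely generated `ℤ_p`-module …
  with a continuous action of `G` … (i) … `H^i(G, T) = lim← H^i(G, T/p^nT)`" — for `i = 1`, `T = T_pE`,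
  `T/p^k ≅ E[p^k]`, `G = U ≤ Γ_K`.
* J. Neukirch, A. Schmidt, K. Wingberg, *Cohomology of Number Fields* (2008) II §7 **Thm. (2.7.5)**:
  `H^n_cts(G, lim← A_i) → lim← H^n(G, A_i)` is surjective with kernel `lim←¹ H^{n-1}(G, A_i)` for a countable
  inverse system of finite modules with surjective transition maps.

## Contents (for `E` an elliptic curve over a field `K`, `p` prime, any subgroup `U ≤ Γ_K`; `red_{p^k} = Kato2004.reduceH1PkK E p k U`)

* §1 **`eq_zero_of_forall_reduceH1PkK_eq_zero`** (separatedness: `red_{p^k} x = 0 ∀ k ⇒ x = 0`; proof on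
  continuous cochains by Kőnig's lemma on the finite non-empty witness sets `{v ∈ E[p^k] | φ ≡ ∂v}`, exactly as in
  the ℚ-twin), with the corollaries `eq_of_forall_reduceH1PkK_eq` (`H¹(U, T_pE) ↪ ∏_k H¹(U, E[p^k])`),
  `eq_zero_of_forall_mem_pow_smulK` (`⋂_k p^k · H¹ = 0`), `pow_smul_eq_zero_of_forall_reduceH1PkK_pow_smul_eq_zero`.
* §2 the transition maps: `geomTorsionReduce_surjectiveK` (`p • : E[p^{k+1}] ↠ E[p^k]`, `E(K̄)` divisible),
  `geomTorsionReduce_subgroupRepK`, `reduceTorsionH1_oneCocycleClassK` (`p_*` on cocycles),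
  `reduceTorsionH1_reduceH1PkK` (`p_* ∘ red_{p^{k+1}} = red_{p^k}`).
* §3 **`exists_reduceH1PkK_eq_of_compatible`** (Rubin B.2.3, surjectivity: a `p_*`-compatible family
  `c_k ∈ H¹(U, E[p^k])` is `(red_{p^k} x)_k` for some `x ∈ H¹(U, T_pE)`; proof = NSW (2.7.5) in degree one on
  cocycles: lift representatives level by level correcting by principal crossed homomorphisms, assemble with
  `TateModule.mk`) and `existsUnique_reduceH1PkK_eq_of_compatible`.
NOT here (vs. the ℚ-twins): §3 of `…Separated` (`p`-power extraction helpers, no K-side consumer), the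
`reduceH1Pow`/`reducePi` dictionary of `…SurjectiveProofs` §2 (the `IwasawaH1CompactSelmer` typing is ℚ-only).

## References
K. Kato, Astérisque 295 (2004) §8.2 (pp. 180–181) [Kato2004Asterisque]; K. Rubin, *Euler Systems* (2000) App. B §2
Prop. B.2.3 [Rubin2000]; J. Neukirch, A. Schmidt, K. Wingberg (2008) II §7 Thm. (2.7.5) [NeukirchSchmidtWingberg2008];
J.-P. Serre, *Galois Cohomology* (1997) I §2.2, §5.1 [SerreGaloisCohomology1997]; J. H. Silverman, *AEC* (2009) III.6.4,
VIII §2 [SilvermanAEC2009]; B. Perrin-Riou, Bull. SMF 115 (1987) §0 [PerrinRiou1987BSMF]; Kőnig's lemma (Mathlib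
`nonempty_sections_of_finite_inverse_system`); tree: the two ℚ-twins (mirrored line by line),
`Kato2004/IwasawaH1ReductionPkNumberField.lean` (`tateModPkK`, `reduceH1PkK`, `zsmul_coe_tateModPkK_succ`,
`transition_subgroupRepK`), `HeegnerModuleIndex.lean` (`geomTorsionReduce`, `reduceTorsionH1`, `torsionH1Over` — any
base field), `PointDivisibilityProofs.lean` (`zsmul_geomPoints_surjective_holds`), `GaloisActionProofs.lean`
(`finite_torsionPoints_holds`), `TateModule.lean` (`TateModule.mk/proj/ext/smul_proj_succ`).
-/

noncomputable section

open scoped NumberField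
open Field CategoryTheory
open Literature.NumberTheory.GaloisRepresentations
open Literature.NumberTheory.EllipticCurves Literature.NumberTheory.EllipticCurves.Kato2004
open Literature.NumberTheory.EllipticCurves.Kato2004.CM (tateRepK)
open WeierstrassCurve (geomPoints geomTorsion)

namespace Literature.NumberTheory.EllipticCurves.Kato2004

variable {K : Type} [Field K] (E : WeierstrassCurve K) [E.IsElliptic] (p : ℕ) [Fact p.Prime]
  [ContinuousSMul ℤ_[p] (E.tateModule p)]

/-! ## §1 Separatedness: a class with all reductions zero is zero -/

/-- **`H¹(U, T_pE)` is separated for the reductions modulo `p^k`** (Kato §8.2 / Rubin App. B Prop. B.2.3,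
injectivity half), over ANY base field `K`.  For every subgroup `U ≤ Γ_K` and every `x ∈ H¹(U, T_pE)`: if
`red_{p^k} x = 0` in `H¹(U, E[p^k])` for every `k` (`Kato2004.reduceH1PkK`), then `x = 0`.  Proof on continuous
cochains: the witness sets `{v ∈ E[p^k] | ∀ g, (φ g)_k = g v − v}` are finite and non-empty and form an inverse
system under `v ↦ p • v`; a section (Kőnig) is an `m ∈ T_pE` with `φ = ∂m`.
[cite: Kato2004Asterisque, §8.2 (p. 180)] [cite: Rubin2000, App. B Prop. B.2.3] [cite: SilvermanAEC2009, Cor. III.6.4] -/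
theorem eq_zero_of_forall_reduceH1PkK_eq_zero (U : Subgroup (absoluteGaloisGroup K))
    (x : H1 (tateRepK E p) U) (hx : ∀ k : ℕ, reduceH1PkK E p k U x = 0) : x = 0 := by
  classical
  have hp : p.Prime := Fact.out
  obtain ⟨φ, rfl⟩ := oneCocycleClass_surjective _ x
  -- the actions of `U` on `T_pE|_U` and on `E[p^k]|_U` are the Galois actions
  have hρ : ∀ (g : U) (a : E.tateModule p),
      (subgroupRep (tateRepK E p).toTopRep U).ρ g a = (g : absoluteGaloisGroup K) • a :=
    fun g a => rfl
  have hρk : ∀ (k : ℕ) (g : U) (v : geomTorsion E ((p : ℤ) ^ k)),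
      (subgroupRep (E.torsionGaloisModule ((p : ℤ) ^ k)).toTopRep U).ρ g v =
        (g : absoluteGaloisGroup K) • v :=
    fun k g v => rfl
  -- for each `k`, a coboundary witness `v_k ∈ E[p^k]` of `φ mod p^k`
  have hk : ∀ k : ℕ, ∃ v : geomTorsion E ((p : ℤ) ^ k), ∀ g : U,
      TateModule.proj p k (φ.1 g) =
        (g : absoluteGaloisGroup K) • (v : geomPoints E) - (v : geomPoints E) := by
    intro k
    have h := hx k
    rw [reduceH1PkK_oneCocycleClass, oneCocycleClass_eq_zero_iff] at h
    obtain ⟨v, hv⟩ := h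
    refine ⟨v, fun g => ?_⟩
    have h1 := congrArg (fun P : geomTorsion E ((p : ℤ) ^ k) => (P : geomPoints E)) (hv g)
    simp only [AddSubgroupClass.coe_sub, hρk, AddSubgroup.torsionBy.coe_smul] at h1
    exact h1
  -- the witness sets `X_k` and the transition maps `v ↦ p • v`
  let X : ℕ → Type := fun k => {v : geomTorsion E ((p : ℤ) ^ k) //
    ∀ g : U, TateModule.proj p k (φ.1 g) =
      (g : absoluteGaloisGroup K) • (v : geomPoints E) - (v : geomPoints E)}
  have hmem : ∀ (k : ℕ) (v : geomTorsion E ((p : ℤ) ^ (k + 1))),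
      p • (v : geomPoints E) ∈ geomTorsion E ((p : ℤ) ^ k) := by
    intro k v
    have hv : ((p : ℤ) ^ (k + 1)) • (v : geomPoints E) = 0 := (Submodule.mem_torsionBy_iff _ _).mp v.2
    refine (Submodule.mem_torsionBy_iff _ _).mpr ?_
    rw [← natCast_zsmul, smul_smul, ← pow_succ, hv]
  have htrans : ∀ (k : ℕ) (v : X (k + 1)) (g : U),
      TateModule.proj p k (φ.1 g) =
        (g : absoluteGaloisGroup K) • (p • ((v.1 : geomTorsion E _) : geomPoints E)) -
          p • ((v.1 : geomTorsion E _) : geomPoints E) := by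
    intro k v g
    rw [← TateModule.smul_proj_succ k (φ.1 g), v.2 g, smul_sub, smul_comm]
  let f₀ : ∀ k, X (k + 1) → X k := fun k v =>
    ⟨⟨p • ((v.1 : geomTorsion E _) : geomPoints E), hmem k v.1⟩, fun g => htrans k v g⟩
  let f : ∀ k, X (k + 1) ⟶ X k := fun k => TypeCat.ofHom (f₀ k)
  let F : ℕᵒᵖ ⥤ Type := Functor.ofOpSequence (X := X) f
  haveI : ∀ j : ℕᵒᵖ, Finite (F.obj j) := fun j => by
    change Finite (X j.unop)
    haveI : Finite (geomTorsion E ((p : ℤ) ^ j.unop)) :=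
      E.finite_torsionPoints_holds (AlgebraicClosure K)
        (pow_ne_zero _ (Int.natCast_ne_zero.mpr hp.ne_zero))
    exact Subtype.finite
  haveI : ∀ j : ℕᵒᵖ, Nonempty (F.obj j) := fun j => by
    change Nonempty (X j.unop)
    obtain ⟨v, hv⟩ := hk j.unop
    exact ⟨⟨v, hv⟩⟩
  -- Kőnig: a compatible family of witnesses
  obtain ⟨s, hs⟩ := nonempty_sections_of_finite_inverse_system F
  have hsucc : ∀ k : ℕ,
      p • (((s (Opposite.op (k + 1)) : X (k + 1)).1 : geomTorsion E _) : geomPoints E) =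
        (((s (Opposite.op k) : X k).1 : geomTorsion E _) : geomPoints E) := by
    intro k
    have h := hs (homOfLE (Nat.le_add_right k 1)).op
    rw [Functor.ofOpSequence_map_homOfLE_succ] at h
    exact congrArg (fun v : X k => ((v.1 : geomTorsion E _) : geomPoints E)) h
  have hpow : ∀ k : ℕ,
      p ^ k • (((s (Opposite.op k) : X k).1 : geomTorsion E _) : geomPoints E) = 0 := by
    intro k
    have hv : ((p : ℤ) ^ k) • (((s (Opposite.op k) : X k).1 : geomTorsion E _) : geomPoints E) = 0 :=
      (Submodule.mem_torsionBy_iff _ _).mp ((s (Opposite.op k) : X k).1).2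
    rw [← natCast_zsmul]
    push_cast
    exact hv
  -- the element `m = (v_k)_k ∈ T_pE` with `φ = ∂m`
  let m : E.tateModule p :=
    TateModule.mk (fun k => (((s (Opposite.op k) : X k).1 : geomTorsion E _) : geomPoints E))
      hpow hsucc
  rw [oneCocycleClass_eq_zero_iff]
  refine ⟨m, fun g => TateModule.ext fun k => ?_⟩
  rw [map_sub, hρ, TateModule.proj_smul_of_distribMulAction]
  simp only [m, TateModule.proj_mk]
  exact (s (Opposite.op k)).2 g

/-- **`H¹(U, T_pE) ↪ ∏_k H¹(U, E[p^k])`**: two classes with the same reduction modulo every `p^k` are equal.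
[cite: Rubin2000, App. B Prop. B.2.3] [cite: Kato2004Asterisque, §8.2 (p. 180)] -/
theorem eq_of_forall_reduceH1PkK_eq (U : Subgroup (absoluteGaloisGroup K))
    {x y : H1 (tateRepK E p) U} (h : ∀ k : ℕ, reduceH1PkK E p k U x = reduceH1PkK E p k U y) :
    x = y := by
  rw [← sub_eq_zero]
  exact eq_zero_of_forall_reduceH1PkK_eq_zero E p U (x - y) fun k => by rw [map_sub, h k, sub_self]

/-- **`⋂_k p^k · H¹(U, T_pE) = 0`**: a class divisible by every power of `p` is zero (`red_{p^k}` kills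
`p^k`-multiples, `reduceH1PkK_pow_smul`, and §1). [cite: Kato2004Asterisque, §8.2 (p. 180) and §13.8 (p. 228)]
[cite: Rubin2000, App. B Prop. B.2.3] -/
theorem eq_zero_of_forall_mem_pow_smulK (U : Subgroup (absoluteGaloisGroup K)) (x : H1 (tateRepK E p) U)
    (hx : ∀ k : ℕ, ∃ y : H1 (tateRepK E p) U, ((p : ℤ_[p]) ^ k) • y = x) : x = 0 :=
  eq_zero_of_forall_reduceH1PkK_eq_zero E p U x fun k => by
    obtain ⟨y, rfl⟩ := hx k
    exact reduceH1PkK_pow_smul E p k U y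

/-- **The assembly shape**: a UNIFORM exponent `e` with `red_{p^k} (p^e • x) = 0` in `H¹(U, E[p^k])` for every
`k` forces `p^e • x = 0` in `H¹(U, T_pE)`. [cite: Rubin2000, App. B Prop. B.2.3] [cite: Kato2004Asterisque, §8.2 (p. 180)] -/
theorem pow_smul_eq_zero_of_forall_reduceH1PkK_pow_smul_eq_zero (U : Subgroup (absoluteGaloisGroup K))
    (x : H1 (tateRepK E p) U) (e : ℕ)
    (hx : ∀ k : ℕ, reduceH1PkK E p k U (((p : ℤ_[p]) ^ e) • x) = 0) :
    ((p : ℤ_[p]) ^ e) • x = 0 :=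
  eq_zero_of_forall_reduceH1PkK_eq_zero E p U _ hx

/-! ## §2 The transition maps `p • : E[p^{k+1}] → E[p^k]` and `p_*` on cocycles -/

omit [ContinuousSMul ℤ_[p] (E.tateModule p)] in
/-- **`p • : E(K̄)[p^{k+1}] → E(K̄)[p^k]` is surjective**: `E(K̄)` is divisible
(`zsmul_geomPoints_surjective_holds`, Silverman VIII §2), and a `p`-th "root" of a `p^k`-torsion point is
`p^{k+1}`-torsion. [cite: SilvermanAEC2009, §VIII.2 and Prop. III.4.2 (a)]
[cite: NeukirchSchmidtWingberg2008, II §7 Thm. 2.7.5 (hypothesis: surjective transition maps)] -/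
theorem geomTorsionReduce_surjectiveK (k : ℕ) : Function.Surjective (E.geomTorsionReduce p k) := by
  intro v
  have hp : (p : ℤ) ≠ 0 := Int.natCast_ne_zero.mpr (Fact.out : p.Prime).ne_zero
  obtain ⟨Q, hQ⟩ := E.zsmul_geomPoints_surjective_holds hp (v : geomPoints E)
  have hQ' : (p : ℤ) • Q = (v : geomPoints E) := hQ
  have hv : ((p : ℤ) ^ k) • (v : geomPoints E) = 0 := (Submodule.mem_torsionBy_iff _ _).mp v.2
  have hmem : Q ∈ geomTorsion E ((p : ℤ) ^ (k + 1)) := by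
    refine (Submodule.mem_torsionBy_iff _ _).mpr ?_
    rw [pow_succ, mul_smul, hQ', hv]
  exact ⟨⟨Q, hmem⟩, Subtype.ext (by rw [WeierstrassCurve.coe_geomTorsionReduce]; exact hQ')⟩

omit [E.IsElliptic] [Fact p.Prime] [ContinuousSMul ℤ_[p] (E.tateModule p)] in
/-- Equivariance of `p • : E[p^{k+1}] → E[p^k]` for the restricted representations `E[p^j]|_U`
(the hypothesis shape of `contOneCocycles.pushAddHom` / `mapH1AddHom`). [cite: PerrinRiou1987BSMF, §0 (p. 401)] -/
theorem geomTorsionReduce_subgroupRepK (k : ℕ) (U : Subgroup (absoluteGaloisGroup K)) (u : U)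
    (P : geomTorsion E ((p : ℤ) ^ (k + 1))) :
    E.geomTorsionReduce p k
        ((subgroupRep (E.torsionGaloisModule ((p : ℤ) ^ (k + 1))).toTopRep U).ρ u P) =
      (subgroupRep (E.torsionGaloisModule ((p : ℤ) ^ k)).toTopRep U).ρ u
        (E.geomTorsionReduce p k P) :=
  transition_subgroupRepK E p k (E.geomTorsionReduce p k) (E.coe_geomTorsionReduce p k) U u P

omit [E.IsElliptic] [Fact p.Prime] [ContinuousSMul ℤ_[p] (E.tateModule p)] in
/-- **`p_*` on explicit cocycles**: the transition map `reduceTorsionH1 : H¹(U, E[p^{k+1}]) → H¹(U, E[p^k])`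
(`HeegnerModuleIndex.lean`, any base field) sends `[φ]` to `[p • φ]` (typed on the restricted representations
`subgroupRep (E.torsionGaloisModule _).toTopRep U`, which ARE `discreteTopRep U E[_]` definitionally).
[cite: PerrinRiou1987BSMF, §0 (p. 401)] [cite: SerreGaloisCohomology1997, I §2.2] -/
theorem reduceTorsionH1_oneCocycleClassK (k : ℕ) (U : Subgroup (absoluteGaloisGroup K))
    (φ : contOneCocycles (subgroupRep (E.torsionGaloisModule ((p : ℤ) ^ (k + 1))).toTopRep U)) :
    E.reduceTorsionH1 p k U
        (oneCocycleClass (subgroupRep (E.torsionGaloisModule ((p : ℤ) ^ (k + 1))).toTopRep U) φ) =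
      oneCocycleClass (subgroupRep (E.torsionGaloisModule ((p : ℤ) ^ k)).toTopRep U)
        (contOneCocycles.pushAddHom (E.geomTorsionReduce p k) continuous_of_discreteTopology
          (geomTorsionReduce_subgroupRepK E p k U) φ) := by
  rw [WeierstrassCurve.reduceTorsionH1, resH1Hom]
  change ContinuousCohomology.map _ _ 1
    (oneCocycleClass (discreteTopRep U (geomTorsion E _)) _) = _
  rw [map_oneCocycleClass]
  congr 1

omit [E.IsElliptic] in
/-- **`p_* ∘ red_{p^{k+1}} = red_{p^k}`** in the `reduceH1PkK` / `reduceTorsionH1` typing (the reductions of ONE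
class of `H¹(U, T_pE)` form a `p_*`-compatible family). [cite: PerrinRiou1987BSMF, §0 (p. 401)]
[cite: Kato2004Asterisque, §8.2 (p. 181)] -/
theorem reduceTorsionH1_reduceH1PkK (k : ℕ) (U : Subgroup (absoluteGaloisGroup K))
    (c : H1 (tateRepK E p) U) :
    E.reduceTorsionH1 p k U (reduceH1PkK E p (k + 1) U c) = reduceH1PkK E p k U c := by
  obtain ⟨φ, rfl⟩ := oneCocycleClass_surjective _ c
  rw [reduceH1PkK_oneCocycleClass, reduceH1PkK_oneCocycleClass, reduceTorsionH1_oneCocycleClassK]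
  congr 1
  refine Subtype.ext (ContinuousMap.ext fun u ↦ Subtype.ext ?_)
  rw [contOneCocycles.pushAddHom_apply, contOneCocycles.pushAddHom_apply,
    contOneCocycles.pushAddHom_apply, WeierstrassCurve.coe_geomTorsionReduce, zsmul_coe_tateModPkK_succ]

/-! ## §3 Rubin B.2.3, surjectivity: compatible families of classes lift to `H¹(U, T_pE)` -/

/-- **Rubin, *Euler Systems*, Prop. B.2.3 / NSW Thm. 2.7.5 in degree one for `T_pE = lim← E[p^k]` over a field
`K` (surjectivity half): `H¹(U, T_pE) → lim←_k H¹(U, E[p^k])` is ONTO.**  For every subgroup `U ≤ Γ_K` and every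
family of classes `c_k ∈ H¹(U, E[p^k])` compatible under the transition maps `p_*` (`WeierstrassCurve.reduceTorsionH1`),
there is a class `x ∈ H¹(U, T_pE)` with `red_{p^k} x = c_k` for every `k`.  Proof on continuous cochains: choose
representatives; since `p • : E[p^{k+1}] → E[p^k]` is onto (§2), correct them level by level by principal crossed
homomorphisms so that `p • φ_{k+1} = φ_k` on the nose; the componentwise limit `g ↦ (φ_k g)_k` is a continuous
crossed homomorphism `U → T_pE`.  [cite: Rubin2000, App. B Prop. B.2.3] [cite: NeukirchSchmidtWingberg2008, II §7 Thm. 2.7.5]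
[cite: Kato2004Asterisque, §8.2 (p. 181)] -/
theorem exists_reduceH1PkK_eq_of_compatible (U : Subgroup (absoluteGaloisGroup K))
    (c : ∀ k : ℕ, E.torsionH1Over ((p : ℤ) ^ k) U)
    (hc : ∀ k, E.reduceTorsionH1 p k U (c (k + 1)) = c k) :
    ∃ x : H1 (tateRepK E p) U, ∀ k, reduceH1PkK E p k U x = c k := by
  classical
  -- representatives
  choose g hg using fun k ↦
    oneCocycleClass_surjective (subgroupRep (E.torsionGaloisModule ((p : ℤ) ^ k)).toTopRep U) (c k)
  -- the Galois actions on the levels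
  have hρk : ∀ (k : ℕ) (u : U) (v : geomTorsion E ((p : ℤ) ^ k)),
      (subgroupRep (E.torsionGaloisModule ((p : ℤ) ^ k)).toTopRep U).ρ u v =
        (u : absoluteGaloisGroup K) • v :=
    fun k u v ↦ rfl
  -- representatives with prescribed class …
  let T : ℕ → Type := fun k ↦
    {f : contOneCocycles (subgroupRep (E.torsionGaloisModule ((p : ℤ) ^ k)).toTopRep U) //
      oneCocycleClass _ f = c k}
  -- … can be lifted EXACTLY along `p •`
  have hstep : ∀ (k : ℕ) (t : T k), ∃ t' : T (k + 1),
      ∀ u : U, E.geomTorsionReduce p k (t'.1.1 u) = t.1.1 u := by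
    intro k t
    let red := contOneCocycles.pushAddHom
      (X := subgroupRep (E.torsionGaloisModule ((p : ℤ) ^ (k + 1))).toTopRep U)
      (Y := subgroupRep (E.torsionGaloisModule ((p : ℤ) ^ k)).toTopRep U)
      (E.geomTorsionReduce p k) continuous_of_discreteTopology (geomTorsionReduce_subgroupRepK E p k U)
    have h1 : oneCocycleClass _ (red (g (k + 1))) = c k := by
      rw [← reduceTorsionH1_oneCocycleClassK, hg, hc]
    have h0 : oneCocycleClass _ (red (g (k + 1)) - t.1) = 0 := by
      rw [oneCocycleClass_sub, h1, t.2, sub_self]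
    obtain ⟨v, hv⟩ := (oneCocycleClass_eq_zero_iff _ _).1 h0
    obtain ⟨v', hv'⟩ := geomTorsionReduce_surjectiveK E p k v
    -- the principal crossed homomorphism of `v'` at level `k + 1`
    let τ := E.torsionGaloisModule (F := K) ((p : ℤ) ^ (k + 1))
    let b : contOneCocycles (subgroupRep (E.torsionGaloisModule ((p : ℤ) ^ (k + 1))).toTopRep U) :=
      ⟨⟨fun u ↦ τ (u : absoluteGaloisGroup K) v' - v',
        ((τ.continuous_apply_left v').comp continuous_subtype_val).sub continuous_const⟩,
        fun u u' ↦ by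
          change τ ((u : absoluteGaloisGroup K) * (u' : absoluteGaloisGroup K)) v' - v' =
            τ (u : absoluteGaloisGroup K) v' - v' +
              τ (u : absoluteGaloisGroup K) (τ (u' : absoluteGaloisGroup K) v' - v')
          rw [map_mul, Module.End.mul_apply, map_sub]
          abel⟩
    have hb : oneCocycleClass _ b = 0 := (oneCocycleClass_eq_zero_iff _ _).2 ⟨v', fun u ↦ rfl⟩
    refine ⟨⟨g (k + 1) - b, by rw [oneCocycleClass_sub, hb, sub_zero, hg]⟩, fun u ↦ ?_⟩
    have hvu := hv u
    rw [Submodule.coe_sub, ContinuousMap.sub_apply, contOneCocycles.pushAddHom_apply] at hvu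
    change E.geomTorsionReduce p k ((g (k + 1)).1 u - (τ (u : absoluteGaloisGroup K) v' - v')) =
      t.1.1 u
    rw [map_sub, map_sub]
    have hτ : E.geomTorsionReduce p k (τ (u : absoluteGaloisGroup K) v') =
        (subgroupRep (E.torsionGaloisModule ((p : ℤ) ^ k)).toTopRep U).ρ u v := by
      rw [← hv']
      exact geomTorsionReduce_subgroupRepK E p k U u v'
    rw [hτ, hv', ← hvu]
    abel
  choose step hstep using hstep
  let F : ∀ k, T k := fun k ↦ Nat.rec (motive := T) ⟨g 0, hg 0⟩ (fun k t ↦ step k t) k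
  have hF : ∀ (k : ℕ) (u : U), E.geomTorsionReduce p k ((F (k + 1)).1.1 u) = (F k).1.1 u :=
    fun k ↦ hstep k (F k)
  -- the componentwise limit is a `T_pE`-valued continuous crossed homomorphism
  have hpow : ∀ (k : ℕ) (u : U),
      p ^ k • (((F k).1.1 u : geomTorsion E ((p : ℤ) ^ k)) : geomPoints E) = 0 := by
    intro k u
    have h : ((p : ℤ) ^ k) • (((F k).1.1 u : geomTorsion E ((p : ℤ) ^ k)) : geomPoints E) = 0 :=
      (Submodule.mem_torsionBy_iff _ _).mp ((F k).1.1 u).2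
    rw [← natCast_zsmul]
    push_cast
    exact h
  have hsucc : ∀ (k : ℕ) (u : U),
      p • (((F (k + 1)).1.1 u : geomTorsion E ((p : ℤ) ^ (k + 1))) : geomPoints E) =
        (((F k).1.1 u : geomTorsion E ((p : ℤ) ^ k)) : geomPoints E) := by
    intro k u
    rw [← natCast_zsmul, ← WeierstrassCurve.coe_geomTorsionReduce, hF]
  let Φv : U → E.tateModule p := fun u ↦
    TateModule.mk (fun k ↦ (((F k).1.1 u : geomTorsion E ((p : ℤ) ^ k)) : geomPoints E))
      (fun k ↦ hpow k u) (fun k ↦ hsucc k u)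
  have hΦv : ∀ (u : U) (k : ℕ), TateModule.proj p k (Φv u) =
      (((F k).1.1 u : geomTorsion E ((p : ℤ) ^ k)) : geomPoints E) := fun u k ↦ rfl
  have hΦcont : Continuous Φv := by
    refine continuous_induced_rng.2 (continuous_pi fun k ↦ ?_)
    exact continuous_subtype_val.comp (F k).1.1.continuous
  have hρ : ∀ (u : U) (a : E.tateModule p),
      (subgroupRep (tateRepK E p).toTopRep U).ρ u a = (u : absoluteGaloisGroup K) • a :=
    fun u a ↦ rfl
  let Φ : contOneCocycles (subgroupRep (tateRepK E p).toTopRep U) :=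
    ⟨⟨Φv, hΦcont⟩, fun u u' ↦ TateModule.ext fun k ↦ by
      change TateModule.proj p k (Φv (u * u')) =
        TateModule.proj p k (Φv u + (subgroupRep (tateRepK E p).toTopRep U).ρ u (Φv u'))
      rw [hρ, map_add, TateModule.proj_smul_of_distribMulAction, hΦv, hΦv, hΦv, (F k).1.2 u u',
        Submodule.coe_add, hρk, AddSubgroup.torsionBy.coe_smul]⟩
  refine ⟨oneCocycleClass _ Φ, fun k ↦ ?_⟩
  rw [reduceH1PkK_oneCocycleClass, ← (F k).2]
  congr 1

/-- **`H¹(U, T_pE) ≅ lim←_k H¹(U, E[p^k])`, existence-and-uniqueness form** (Rubin B.2.3 (i) for `i = 1` over a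
field `K`): a `p_*`-compatible family of classes is the family of reductions of EXACTLY ONE class of `H¹(U, T_pE)`
(existence: `exists_reduceH1PkK_eq_of_compatible`; uniqueness: `eq_of_forall_reduceH1PkK_eq`).
[cite: Rubin2000, App. B Prop. B.2.3] [cite: NeukirchSchmidtWingberg2008, II §7 Thm. 2.7.5] -/
theorem existsUnique_reduceH1PkK_eq_of_compatible (U : Subgroup (absoluteGaloisGroup K))
    (c : ∀ k : ℕ, E.torsionH1Over ((p : ℤ) ^ k) U)
    (hc : ∀ k, E.reduceTorsionH1 p k U (c (k + 1)) = c k) :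
    ∃! x : H1 (tateRepK E p) U, ∀ k, reduceH1PkK E p k U x = c k := by
  obtain ⟨x, hx⟩ := exists_reduceH1PkK_eq_of_compatible E p U c hc
  exact ⟨x, hx, fun y hy ↦ eq_of_forall_reduceH1PkK_eq E p U fun k ↦ by rw [hx k, hy k]⟩

end Literature.NumberTheory.EllipticCurves.Kato2004

end
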